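import Mathlib

/-!
# AtomicCalibrationR (stmt-QuantumFields-28169), E2 `stub_offDiagonalWhitney` — derivative bounds for product grid bumps
# (Plan A, step 3 helper `norm_iteratedFDeriv_prod_bump_le` of planner ym-idea-11 g15's `STUB-PLAN-offDiagonalWhitney.md`)

Prover w4 g22 (free hands).  Two def-free lemmas, Mathlib only:

* `norm_iteratedFDeriv_prod_le_pow` — **Leibniz–multinomial bound**: if every factor of a finite product of real `C^∞` functions has
  geometric derivative bounds `‖D^j f_i‖ ≤ M^j` (`j ≤ m`), then `‖D^m ∏_{i ∈ u} f_i‖ ≤ (#u · M)^m` (Mathlib's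
  `norm_iteratedFDeriv_prod_le` + the multinomial identity `Σ_{p ∈ u.sym m} countPerms p = #u^m`, i.e. `Finset.sum_pow` at `1`);
* `norm_iteratedFDeriv_gridBump_le` — the **product grid bump** `z ↦ ∏_{(l,i)} φ(z_{l,i}/h − c_{l,i})` on `(Fin n → ℝ⁴)` built from a
  one-dimensional `C^∞` profile with `|φ| ≤ 1` has `‖D^m‖ ≤ (A · 4n)^m / h^m` for `0 < h ≤ 1`, `m ≤ N'`, with `A` depending only on
  `φ` and `N'` (each factor is `φ ∘` (a coordinate functional of norm `≤ 1`, scaled by `h⁻¹`): `ContinuousLinearMap.iteratedFDeriv_comp_right`).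

No stub/crux/rung/summit is closed; nothing here touches Yang–Mills; the YM mass gap is NOT proved. [folklore]
-/

set_option autoImplicit false

noncomputable section

open scoped BigOperators ContDiff
open Set

namespace Summit.QuantumFields.YangMills.Cruxes.AtomicCalibrationR.ProductBump

variable {E : Type} [NormedAddCommGroup E] [NormedSpace ℝ E]

/-! ## The Leibniz–multinomial bound -/

/-- The multinomial identity `Σ_{p ∈ u.sym m} countPerms p = (#u)^m` (the multinomial theorem at `x ≡ 1`). -/
theorem sum_countPerms_eq_card_pow {ι : Type*} [DecidableEq ι] (u : Finset ι) (m : ℕ) :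
    ∑ p ∈ u.sym m, ((p : Multiset ι).countPerms : ℝ) = (u.card : ℝ) ^ m := by
  have h := Finset.sum_pow (s := u) (fun _ : ι => (1 : ℝ)) m
  simp only [Finset.sum_const, nsmul_eq_mul, mul_one, Multiset.map_const', Multiset.prod_replicate, one_pow] at h
  exact h.symm

/-- **Leibniz–multinomial bound.**  For a finite product of real `C^∞` functions whose factors satisfy `‖D^j f_i(x)‖ ≤ M^j` for
`j ≤ m`: `‖D^m (∏_{i ∈ u} f_i)(x)‖ ≤ (#u · M)^m`. [folklore] -/
theorem norm_iteratedFDeriv_prod_le_pow {ι : Type*} [DecidableEq ι] (u : Finset ι) (f : ι → E → ℝ)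
    (hf : ∀ i ∈ u, ContDiff ℝ ∞ (f i)) {M : ℝ} (m : ℕ) (x : E)
    (hb : ∀ i ∈ u, ∀ j : ℕ, j ≤ m → ‖iteratedFDeriv ℝ j (f i) x‖ ≤ M ^ j) :
    ‖iteratedFDeriv ℝ m (fun x => ∏ i ∈ u, f i x) x‖ ≤ ((u.card : ℝ) * M) ^ m := by
  have h1 := norm_iteratedFDeriv_prod_le (𝕜 := ℝ) (u := u) (f := f) (N := (⊤ : ℕ∞)) (x := x) (n := m)
    (fun i hi => hf i hi) (by exact_mod_cast le_top)
  refine h1.trans ?_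
  -- each summand is at most `countPerms p * M^m`
  have hterm : ∀ p ∈ u.sym m, ((p : Multiset ι).countPerms : ℝ) *
      ∏ j ∈ u, ‖iteratedFDeriv ℝ ((p : Multiset ι).count j) (f j) x‖ ≤ ((p : Multiset ι).countPerms : ℝ) * M ^ m := by
    intro p hp
    refine mul_le_mul_of_nonneg_left ?_ (Nat.cast_nonneg _)
    have hps : ∀ a ∈ (p : Multiset ι), a ∈ u := Finset.mem_sym_iff.1 hp
    have hcount : ∀ j ∈ u, (p : Multiset ι).count j ≤ m := fun j _ =>
      (Multiset.count_le_card j _).trans (le_of_eq (Sym.card_coe))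
    calc ∏ j ∈ u, ‖iteratedFDeriv ℝ ((p : Multiset ι).count j) (f j) x‖
        ≤ ∏ j ∈ u, M ^ (p : Multiset ι).count j :=
          Finset.prod_le_prod (fun j _ => norm_nonneg _) fun j hj => hb j hj _ (hcount j hj)
      _ = M ^ ∑ j ∈ u, (p : Multiset ι).count j := (Finset.prod_pow_eq_pow_sum u _ M)
      _ = M ^ m := by rw [Multiset.sum_count_eq_card hps, Sym.card_coe]
  calc ∑ p ∈ u.sym m, ((p : Multiset ι).countPerms : ℝ) * ∏ j ∈ u, ‖iteratedFDeriv ℝ ((p : Multiset ι).count j) (f j) x‖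
      ≤ ∑ p ∈ u.sym m, ((p : Multiset ι).countPerms : ℝ) * M ^ m := Finset.sum_le_sum hterm
    _ = (u.card : ℝ) ^ m * M ^ m := by rw [← Finset.sum_mul, sum_countPerms_eq_card_pow]
    _ = ((u.card : ℝ) * M) ^ m := by rw [mul_pow]

/-! ## The product grid bump on `(Fin n → ℝ⁴)` -/

/-- The coordinate functional `z ↦ z_{l,i}` on `Fin n → ℝ⁴`, as a continuous linear map of norm `≤ 1`. -/
theorem norm_coordCLM_le (n : ℕ) (l : Fin n) (i : Fin 4) :
    ‖(EuclideanSpace.proj i : EuclideanSpace ℝ (Fin 4) →L[ℝ] ℝ).comp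
        (ContinuousLinearMap.proj l : (Fin n → EuclideanSpace ℝ (Fin 4)) →L[ℝ] EuclideanSpace ℝ (Fin 4))‖ ≤ 1 := by
  refine ContinuousLinearMap.opNorm_le_bound _ zero_le_one fun z => ?_
  rw [one_mul, ContinuousLinearMap.comp_apply]
  calc ‖(EuclideanSpace.proj i : EuclideanSpace ℝ (Fin 4) →L[ℝ] ℝ) ((ContinuousLinearMap.proj l :
        (Fin n → EuclideanSpace ℝ (Fin 4)) →L[ℝ] EuclideanSpace ℝ (Fin 4)) z)‖ = ‖z l i‖ := rfl
    _ ≤ ‖z l‖ := by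
        have h := PiLp.norm_apply_le (z l) i
        exact h
    _ ≤ ‖z‖ := norm_le_pi_norm z l

/-- Derivative bounds of one factor `z ↦ φ(z_{l,i}/h − c)`: `‖D^j‖ ≤ sup‖D^j φ‖ / h^j` for `0 < h ≤ 1`. -/
theorem norm_iteratedFDeriv_factor_le (φ : ℝ → ℝ) (hφ : ContDiff ℝ ∞ φ) {D : ℕ → ℝ}
    (hD : ∀ j t, ‖iteratedFDeriv ℝ j φ t‖ ≤ D j) {n : ℕ} (l : Fin n) (i : Fin 4) {h : ℝ} (hh : 0 < h) (c : ℝ)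
    (j : ℕ) (z : Fin n → EuclideanSpace ℝ (Fin 4)) :
    ‖iteratedFDeriv ℝ j (fun z : Fin n → EuclideanSpace ℝ (Fin 4) => φ (z l i / h - c)) z‖ ≤ D j / h ^ j := by
  -- the factor is `φ ∘ (t ↦ t - c) ∘ L` with `L = h⁻¹ • coordinate`
  set L : (Fin n → EuclideanSpace ℝ (Fin 4)) →L[ℝ] ℝ :=
    h⁻¹ • ((EuclideanSpace.proj i : EuclideanSpace ℝ (Fin 4) →L[ℝ] ℝ).comp
      (ContinuousLinearMap.proj l : (Fin n → EuclideanSpace ℝ (Fin 4)) →L[ℝ] EuclideanSpace ℝ (Fin 4))) with hL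
  have hLapp : ∀ z : Fin n → EuclideanSpace ℝ (Fin 4), L z = z l i / h := by
    intro z
    simp only [hL, FunLike.coe_smul, Pi.smul_apply, ContinuousLinearMap.comp_apply, smul_eq_mul]
    rw [div_eq_inv_mul]
    rfl
  set ψ : ℝ → ℝ := fun t => φ (t - c) with hψ
  have hψd : ContDiff ℝ ∞ ψ := hφ.comp (contDiff_id.sub contDiff_const)
  have hψD : ∀ j t, ‖iteratedFDeriv ℝ j ψ t‖ ≤ D j := by
    intro j t
    rw [hψ, iteratedFDeriv_comp_sub]
    exact hD j _
  have hfun : (fun z : Fin n → EuclideanSpace ℝ (Fin 4) => φ (z l i / h - c)) = ψ ∘ L := by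
    funext z; simp only [Function.comp_apply, hψ, hLapp]
  rw [hfun, ContinuousLinearMap.iteratedFDeriv_comp_right L hψd z (by exact_mod_cast le_top)]
  have hLn : ‖L‖ ≤ h⁻¹ := by
    rw [hL, norm_smul, Real.norm_eq_abs, abs_of_pos (inv_pos.2 hh)]
    exact mul_le_of_le_one_right (inv_pos.2 hh).le (norm_coordCLM_le n l i)
  have h1 := ContinuousMultilinearMap.norm_compContinuousLinearMap_le (iteratedFDeriv ℝ j ψ (L z)) (fun _ => L)
  simp only [Finset.prod_const, Finset.card_univ, Fintype.card_fin] at h1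
  refine h1.trans ?_
  rw [div_eq_mul_inv, ← inv_pow]
  have hD0 : 0 ≤ D j := (norm_nonneg _).trans (hD j 0)
  exact mul_le_mul (hψD j _) (pow_le_pow_left₀ (norm_nonneg _) hLn j) (by positivity) hD0

/-- **Derivative bounds for product grid bumps** (`norm_iteratedFDeriv_prod_bump_le` of the plan): for a `C^∞` profile `φ` on `ℝ`
with `|φ| ≤ 1` and bounded derivatives, there is `A ≥ 0` (depending on `φ` and the derivative budget `N'` only) such that for
every `n`, mesh `0 < h ≤ 1`, integer offsets `c` and `m ≤ N'`:
`‖D^m (z ↦ ∏_{(l,i)} φ(z_{l,i}/h − c_{l,i}))‖ ≤ (A · 4n)^m / h^m`. [folklore] -/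
theorem norm_iteratedFDeriv_gridBump_le (φ : ℝ → ℝ) (hφ : ContDiff ℝ ∞ φ) (hφ1 : ∀ t, |φ t| ≤ 1)
    {D : ℕ → ℝ} (hD : ∀ j t, ‖iteratedFDeriv ℝ j φ t‖ ≤ D j) (N' : ℕ) :
    ∃ A : ℝ, 0 ≤ A ∧ ∀ (n : ℕ) (h : ℝ), 0 < h → h ≤ 1 → ∀ (c : Fin n → Fin 4 → ℤ) (m : ℕ), m ≤ N' →
      ∀ z : Fin n → EuclideanSpace ℝ (Fin 4),
        ‖iteratedFDeriv ℝ m (fun z : Fin n → EuclideanSpace ℝ (Fin 4) =>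
            ∏ p : Fin n × Fin 4, φ (z p.1 p.2 / h - c p.1 p.2)) z‖ ≤ (A * (4 * n)) ^ m / h ^ m := by
  classical
  -- `A := 1 + Σ_{j ≤ N'} D_j` dominates `1` and every `D_j`, `j ≤ N'`
  have hD0 : ∀ j, 0 ≤ D j := fun j => (norm_nonneg _).trans (hD j 0)
  set A : ℝ := 1 + ∑ j ∈ Finset.range (N' + 1), D j with hA
  have hA1 : 1 ≤ A := by
    have : 0 ≤ ∑ j ∈ Finset.range (N' + 1), D j := Finset.sum_nonneg fun j _ => hD0 j
    linarith
  have hAD : ∀ j, j ≤ N' → D j ≤ A := by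
    intro j hj
    have : D j ≤ ∑ j ∈ Finset.range (N' + 1), D j :=
      Finset.single_le_sum (fun j _ => hD0 j) (Finset.mem_range.2 (Nat.lt_succ_of_le hj))
    linarith
  refine ⟨A, by linarith, fun n h hh hh1 c m hm z => ?_⟩
  -- geometric bounds `M^j`, `M = A/h`, for every factor and every `j ≤ m`
  have hb : ∀ p ∈ (Finset.univ : Finset (Fin n × Fin 4)), ∀ j : ℕ, j ≤ m →
      ‖iteratedFDeriv ℝ j (fun z : Fin n → EuclideanSpace ℝ (Fin 4) => φ (z p.1 p.2 / h - c p.1 p.2)) z‖ ≤ (A / h) ^ j := by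
    intro p _ j hj
    rcases Nat.eq_zero_or_pos j with hj0 | hjpos
    · subst hj0
      rw [pow_zero, norm_iteratedFDeriv_zero, Real.norm_eq_abs]
      exact hφ1 _
    · have h1 := norm_iteratedFDeriv_factor_le φ hφ hD p.1 p.2 hh (c p.1 p.2 : ℝ) j z
      refine h1.trans ?_
      rw [div_pow]
      refine div_le_div_of_nonneg_right ?_ (pow_pos hh j).le
      calc D j ≤ A := hAD j (hj.trans hm)
        _ ≤ A ^ j := le_self_pow₀ hA1 (Nat.pos_iff_ne_zero.1 hjpos)
  have hcoord : ∀ p : Fin n × Fin 4, ContDiff ℝ ∞ (fun z : Fin n → EuclideanSpace ℝ (Fin 4) => z p.1 p.2) := fun p =>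
    ((EuclideanSpace.proj p.2 : EuclideanSpace ℝ (Fin 4) →L[ℝ] ℝ).comp
      (ContinuousLinearMap.proj p.1 : (Fin n → EuclideanSpace ℝ (Fin 4)) →L[ℝ] EuclideanSpace ℝ (Fin 4))).contDiff
  have hf' : ∀ p ∈ (Finset.univ : Finset (Fin n × Fin 4)),
      ContDiff ℝ ∞ (fun z : Fin n → EuclideanSpace ℝ (Fin 4) => φ (z p.1 p.2 / h - c p.1 p.2)) := by
    intro p _
    have h2 : ContDiff ℝ ∞ (fun z : Fin n → EuclideanSpace ℝ (Fin 4) => z p.1 p.2 / h - (c p.1 p.2 : ℝ)) :=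
      ((hcoord p).div_const h).sub contDiff_const
    exact hφ.comp h2
  have hprod := norm_iteratedFDeriv_prod_le_pow (E := Fin n → EuclideanSpace ℝ (Fin 4))
    (Finset.univ : Finset (Fin n × Fin 4))
    (fun (p : Fin n × Fin 4) (z : Fin n → EuclideanSpace ℝ (Fin 4)) => φ (z p.1 p.2 / h - c p.1 p.2)) hf' m z hb
  refine hprod.trans (le_of_eq ?_)
  rw [Finset.card_univ, Fintype.card_prod, Fintype.card_fin, Fintype.card_fin, mul_pow, mul_pow, div_pow, mul_div_assoc]
  push_cast
  ring

end Summit.QuantumFields.YangMills.Cruxes.AtomicCalibrationR.ProductBump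

end
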